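import Mathlib
import Summits.CriticalPhenomena.PercolationContinuityZ3.Theorems.PercNearOneGluingNoHeavyLowerTailHexMSMatchExtReserved
import Summits.CriticalPhenomena.PercolationContinuityZ3.Theorems.PercNearOneGluingNoHeavyLowerTailHexMSMatchMS2Instance

/-!
# The hybrid certificate: Marica–Schönheim on `P ∪ co Q` proves (Π2″) for pair-saturated blocks (hp-7 gen 80)

Support file for crux `stmt-CriticalPhenomena-4575` (route `PercNearOneGluingNoHeavy`), hull-port seat `prim-hp-7` (generation 80);
`--supports stmt-CriticalPhenomena-4575 --as helper`.  No `sorry`.  Memo: `run/shared/lean/prim/prim-hp-7/FROM-prim-hp-7-g80-TWO-DIRECTIONS.md` §4.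

All order certificates of gens 76–78 rank the dead family `F = P ∪ Q` (labels `i`, `i+1`).  In such a rank every designated cross difference
`p \ q` or `q \ p` is a forward difference of one of the two block orders, so 'NO-GO pairs' (both `p \ q` and `q \ p` designated) need new second
differences.  This file ranks instead the HYBRID family `H = P ∪ {U \ q : q ∈ Q}` — the dead classes of labels `i` and `i+4`, the two classes
ADJACENT TO THE BLOCKER CLASS `i+5`.  With `P` first (by decreasing size) and the complements after (by decreasing size), the forward differences are
`p \ p'`, `q' \ q` and the cross MEETS `p \ (U \ q) = p ∩ q`, which are nonempty because `F` is pairwise intersecting; and NO designated set is ever a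
forward difference (`d₅ ⊄ q`, `p ∪ w ≠ U`).  The meet `p ∩ q` is a term as soon as the pair `(p, q)` is designated in at least one direction:
`p ∩ q = p \ (p \ q) ∈ P \\ W` or `p ∩ q = q ∩ (p ∪ (U \ q)) ∈ Q ⊼ W`.

* `Hybrid.card_add_card_le_card_of_cross_intersecting` — **Marica–Schönheim for two cross-intersecting families with meets**: if every
  `x ∈ X` meets every `y ∈ Y` then `#X + #Y ≤ #((X \\ X) ∪ (Y \\ Y) ∪ (X ⊼ Y))`.  (Ordered MS on `X ∪ co Y`.)
* `Hybrid.two_mul_card_le_card_clU_scTerms_of_saturated` — **(Π2″) for pair-saturated dead-like blocks**: `P`, `Q` dead-like in `U`, `W ⊆ scReps U P Q`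
  complement-free and pure (`C2`), `w ⊄ q` and `p ∪ w ≠ U` for `w ∈ W`, `p ∈ P`, `q ∈ Q`, and every cross pair designated in some direction
  (`p \ q ∈ W ∨ p ∪ (U \ q) ∈ W`).  Then `2 (#P + #Q + #W) ≤ #clU U (scTerms P Q W)`.
* (file `…HexMSMatchHybridBridge`) `Hybrid.card_le_card_farNbhd_of_saturated` — the (MATCH*) form for depth-one saturated two-class antipodal
  instances whose dead classes `i`, `i+1` are pair-saturated by the blockers of label `i+5`; the side conditions follow from deadness.
Numerically (memo §4): pair saturation holds for ALL 3 240 + 1 452 instances of the gen-78 residue lists on `2^[6]` and for the 'parallel'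
configurations `P = a + X`, `Q = b + X` (`X` MS-tight), the tightest derived configurations known (margins 0 in both label directions).
-/

namespace Summit.CriticalPhenomena.PercolationContinuityZ3.Theorems

namespace Hybrid

open Finset GeneratedDonors
open scoped FinsetFamily

variable {α : Type*} [DecidableEq α] {U : Finset α}

/-- **Marica–Schönheim for two cross-intersecting families, with meets** (hp-7 gen 80).  If every member of `X` meets every member of
`Y`, then `#X + #Y ≤ #((X \\ X) ∪ (Y \\ Y) ∪ (X ⊼ Y))`.  (Rank `X` by decreasing size before the complements `S \ y` by decreasing size,
`S = ⋃ (X ∪ Y)`: the forward differences are `x \ x'`, `x ∩ y` and `y' \ y`, all nonempty.) -/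
theorem card_add_card_le_card_of_cross_intersecting (X Y : Finset (Finset α))
    (hXY : ∀ x ∈ X, ∀ y ∈ Y, (x ∩ y).Nonempty) :
    #X + #Y ≤ #((X \\ X) ∪ (Y \\ Y) ∪ (X ⊼ Y)) := by
  classical
  rcases X.eq_empty_or_nonempty with hX0 | ⟨x₀, hx₀⟩
  · rw [hX0]; simp [Finset.card_le_card_diffs]
  rcases Y.eq_empty_or_nonempty with hY0 | ⟨y₀, hy₀⟩
  · rw [hY0]; simp [Finset.card_le_card_diffs]
  set S : Finset α := (X ∪ Y).sup id with hS
  have hXS : ∀ {x}, x ∈ X → x ⊆ S := fun hx => le_sup (f := id) (mem_union_left _ hx)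
  have hYS : ∀ {y}, y ∈ Y → y ⊆ S := fun hy => le_sup (f := id) (mem_union_right _ hy)
  have hcc : ∀ {a : Finset α}, a ⊆ S → S \ (S \ a) = a := fun ha => Finset.sdiff_sdiff_eq_self ha
  set cY : Finset (Finset α) := Y.image fun y => S \ y with hcY
  have hcardcY : #cY = #Y := by
    refine card_image_of_injOn ?_
    intro y hy y' hy' h
    have h1 := congrArg (fun t => S \ t) h
    simp only [hcc (hYS (mem_coe.mp hy)), hcc (hYS (mem_coe.mp hy'))] at h1
    exact h1
  have hdisj : Disjoint X cY := by
    rw [Finset.disjoint_left]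
    intro x hx hxc
    obtain ⟨y, hy, hyx⟩ := mem_image.mp hxc
    obtain ⟨i, hi⟩ := hXY x hx y hy
    rw [← hyx, mem_inter, mem_sdiff] at hi
    exact hi.1.2 hi.2
  set H := X ∪ cY with hH
  have hcardH : #H = #X + #Y := by rw [card_union_of_disjoint hdisj, hcardcY]
  set T := (X \\ X) ∪ (Y \\ Y) ∪ (X ⊼ Y) with hT
  set M : ℕ := #S with hM
  let r : Finset α → ℤ := fun s => (if s ∈ X then 0 else (M : ℤ) + 1) - (#s : ℤ)
  have h0T : (∅ : Finset α) ∈ T :=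
    mem_union_left _ (mem_union_left _ (mem_diffs.mpr ⟨x₀, hx₀, x₀, hx₀, (by simp : x₀ \ x₀ = ∅)⟩))
  have hres := ReservedTerms.card_add_card_le_card_of_reserved H T ∅ r h0T (empty_subset _) (notMem_empty _) ?_
  · rw [hcardH, card_empty, add_zero] at hres; exact hres
  intro f hf g hg hne hr
  have hsizeS : ∀ {s : Finset α}, s ⊆ S → #s ≤ M := fun hs => card_le_card hs
  rcases mem_union.mp hf with hfX | hfc <;> rcases mem_union.mp hg with hgX | hgc
  · -- `X`/`X`: larger first
    have hle : #g ≤ #f := by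
      have : r f ≤ r g := hr
      simp only [r, if_pos hfX, if_pos hgX] at this; omega
    refine ⟨mem_union_left _ (mem_union_left _ (mem_diffs.mpr ⟨f, hfX, g, hgX, rfl⟩)), ?_, notMem_empty _⟩
    intro h0
    exact hne (eq_of_subset_of_card_le (sdiff_eq_empty_iff_subset.mp h0) hle)
  · -- `X` before `co Y`: the meet
    obtain ⟨y, hy, rfl⟩ := mem_image.mp hgc
    have hmeet : f \ (S \ y) = f ∩ y := by
      ext i; simp only [mem_sdiff, mem_inter]
      constructor
      · rintro ⟨hif, h⟩
        refine ⟨hif, ?_⟩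
        by_contra hiy; exact h ⟨hXS hfX hif, hiy⟩
      · rintro ⟨hif, hiy⟩; exact ⟨hif, fun h => h.2 hiy⟩
    rw [hmeet]
    exact ⟨mem_union_right _ (mem_infs.mpr ⟨f, hfX, y, hy, rfl⟩), (hXY f hfX y hy).ne_empty, notMem_empty _⟩
  · -- `co Y` before `X`: impossible
    exfalso
    have hfX' : f ∉ X := fun h => (Finset.disjoint_left.mp hdisj) h hfc
    have hr' : r f ≤ r g := hr
    simp only [r, if_neg hfX', if_pos hgX] at hr'
    obtain ⟨y, hy, rfl⟩ := mem_image.mp hfc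
    have := hsizeS (sdiff_subset : S \ y ⊆ S)
    omega
  · -- `co Y`/`co Y`
    obtain ⟨y, hy, rfl⟩ := mem_image.mp hfc
    obtain ⟨y', hy', rfl⟩ := mem_image.mp hgc
    have hfX' : S \ y ∉ X := fun h => (Finset.disjoint_left.mp hdisj) h hfc
    have hgX' : S \ y' ∉ X := fun h => (Finset.disjoint_left.mp hdisj) h hgc
    have hle : #(S \ y') ≤ #(S \ y) := by
      have : r (S \ y) ≤ r (S \ y') := hr
      simp only [r, if_neg hfX', if_neg hgX'] at this; omega
    have hdiff : (S \ y) \ (S \ y') = y' \ y := by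
      ext i; simp only [mem_sdiff]
      constructor
      · rintro ⟨⟨hiS, hiy⟩, h⟩
        exact ⟨by by_contra h'; exact h ⟨hiS, h'⟩, hiy⟩
      · rintro ⟨hiy', hiy⟩; exact ⟨⟨hYS hy' hiy', hiy⟩, fun h => h.2 hiy'⟩
    rw [hdiff]
    refine ⟨mem_union_left _ (mem_union_right _ (mem_diffs.mpr ⟨y', hy', y, hy, rfl⟩)), ?_, notMem_empty _⟩
    intro h0
    have hsub : y' ⊆ y := sdiff_eq_empty_iff_subset.mp h0
    have : S \ y ⊆ S \ y' := sdiff_subset_sdiff subset_rfl hsub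
    exact hne (eq_of_subset_of_card_le this hle)

/-- **(Π2″) for pair-saturated dead-like blocks — the hybrid certificate** (hp-7 gen 80).  `P`, `Q` pairwise intersecting and
non-covering families (disjointness is not even needed) of subsets of `U`; blockers `W ⊆ scReps U P Q`, complement-free, pure (`w ∉ clU U (P \\ P ∪ Q \\ Q)`), with `w ⊄ q` and
`p ∪ w ≠ U`; and every cross pair designated in some direction: `p \ q ∈ W ∨ p ∪ (U \ q) ∈ W`.  Then `2 (#P + #Q + #W) ≤ #clU U (scTerms P Q W)`.
(Ordered Marica–Schönheim on `P ∪ co Q` with the designated sets reserved: they are never forward differences of the hybrid family.) -/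
theorem two_mul_card_le_card_clU_scTerms_of_saturated (P Q W : Finset (Finset α))
    (hU : ∀ a ∈ P ∪ Q, a ⊆ U)
    (hint : ∀ a ∈ P ∪ Q, ∀ b ∈ P ∪ Q, (a ∩ b).Nonempty) (hcov : ∀ a ∈ P ∪ Q, ∀ b ∈ P ∪ Q, a ∪ b ≠ U)
    (hrep : W ⊆ scReps U P Q) (hWco : ∀ a ∈ W, ∀ b ∈ W, a ≠ U \ b)
    (hC2 : ∀ w ∈ W, w ∉ clU U ((P \\ P) ∪ (Q \\ Q)))
    (hX1W : ∀ w ∈ W, ∀ q ∈ Q, ¬ w ⊆ q) (hX2W : ∀ p ∈ P, ∀ w ∈ W, p ∪ w ≠ U)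
    (hsat : ∀ p ∈ P, ∀ q ∈ Q, p \ q ∈ W ∨ p ∪ (U \ q) ∈ W) :
    2 * (#P + #Q + #W) ≤ #(clU U (scTerms P Q W)) := by
  classical
  set F := P ∪ Q with hFdef
  have hPF : ∀ {a}, a ∈ P → a ∈ F := fun ha => mem_union_left _ ha
  have hQF : ∀ {a}, a ∈ Q → a ∈ F := fun ha => mem_union_right _ ha
  have hcc : ∀ {a : Finset α}, a ⊆ U → U \ (U \ a) = a := fun ha => Finset.sdiff_sdiff_eq_self ha
  have hWU : ∀ w ∈ W, w ⊆ U := fun w hw => subset_of_mem_scReps hU (hrep hw)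
  -- the designated sets
  set D₅ : Finset (Finset α) := (P \\ Q).filter fun d => d ∈ W with hD₅def
  set D₂ : Finset (Finset α) := (Q \\ P).filter fun d => U \ d ∈ W with hD₂def
  set D := D₅ ∪ D₂ with hDdef
  have hWD : #W ≤ #D := ExtReserved.card_le_card_designated P Q W hU hrep hWco
  -- degenerate blocks
  rcases P.eq_empty_or_nonempty with hP0 | ⟨p₀, hp₀⟩
  · -- no `P`: no representatives, `W = ∅`, and (Π2″) is Marica–Schönheim for `Q`
    have hW0 : W = ∅ := by
      rw [eq_empty_iff_forall_notMem]; intro w hw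
      have := hrep hw; rw [hP0] at this; unfold scReps at this; simp at this
    have hsub : clU U (Q \\ Q) ⊆ clU U (scTerms P Q W) := by
      intro t ht
      rcases mem_clU.mp ht with h | ⟨s, hs, rfl⟩
      · refine mem_clU.mpr (Or.inl ?_); unfold scTerms; simp only [mem_union]
        exact Or.inl (Or.inl (Or.inl (Or.inl (Or.inl (Or.inl (Or.inr h))))))
      · refine mem_clU.mpr (Or.inr ⟨s, ?_, rfl⟩); unfold scTerms; simp only [mem_union]
        exact Or.inl (Or.inl (Or.inl (Or.inl (Or.inl (Or.inl (Or.inr hs))))))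
    have h1 := card_le_card hsub
    rw [card_clU_diffs Q (fun a ha => hU a (hQF ha)) (fun a ha b hb => hcov a (hQF ha) b (hQF hb))] at h1
    have h2 := Q.card_le_card_diffs
    have hcP : #P = 0 := by rw [hP0]; rfl
    have hcW : #W = 0 := by rw [hW0]; rfl
    omega
  rcases Q.eq_empty_or_nonempty with hQ0 | ⟨q₀, hq₀⟩
  · have hW0 : W = ∅ := by
      rw [eq_empty_iff_forall_notMem]; intro w hw
      have := hrep hw; rw [hQ0] at this; unfold scReps at this; simp at this
    have hsub : clU U (P \\ P) ⊆ clU U (scTerms P Q W) := by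
      intro t ht
      rcases mem_clU.mp ht with h | ⟨s, hs, rfl⟩
      · refine mem_clU.mpr (Or.inl ?_); unfold scTerms; simp only [mem_union]
        exact Or.inl (Or.inl (Or.inl (Or.inl (Or.inl (Or.inl (Or.inl h))))))
      · refine mem_clU.mpr (Or.inr ⟨s, ?_, rfl⟩); unfold scTerms; simp only [mem_union]
        exact Or.inl (Or.inl (Or.inl (Or.inl (Or.inl (Or.inl (Or.inl hs))))))
    have h1 := card_le_card hsub
    rw [card_clU_diffs P (fun a ha => hU a (hPF ha)) (fun a ha b hb => hcov a (hPF ha) b (hPF hb))] at h1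
    have h2 := P.card_le_card_diffs
    have hcQ : #Q = 0 := by rw [hQ0]; rfl
    have hcW : #W = 0 := by rw [hW0]; rfl
    omega
  -- facts about designated sets
  have hDsmall : ∀ d ∈ D, d ∈ scTerms P Q W ∧ (∃ f ∈ F, d ⊆ f) ∧ d ∉ (P \\ P) ∪ (Q \\ Q) ∧
      ∀ p ∈ P, ∀ q ∈ Q, d ≠ p ∩ q := by
    intro d hd
    rcases mem_union.mp hd with hd | hd
    · obtain ⟨hdPQ, hdW⟩ := mem_filter.mp hd
      obtain ⟨p, hp, q, hq, rfl⟩ := mem_diffs.mp hdPQ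
      refine ⟨?_, ⟨p, hPF hp, sdiff_subset⟩, fun h => hC2 _ hdW (mem_clU.mpr (Or.inl h)), ?_⟩
      · unfold scTerms; simp only [mem_union]
        exact Or.inl (Or.inl (Or.inl (Or.inl (Or.inl (Or.inr (mem_diffs.mpr ⟨p, hp, q, hq, rfl⟩))))))
      · intro p' hp' q' hq' h
        exact hX1W _ hdW q' hq' (h ▸ inter_subset_right)
    · obtain ⟨hdQP, hdW⟩ := mem_filter.mp hd
      obtain ⟨q, hq, p, hp, rfl⟩ := mem_diffs.mp hdQP
      refine ⟨?_, ⟨q, hQF hq, sdiff_subset⟩, fun h => hC2 _ hdW (mem_clU.mpr (Or.inr ⟨_, h, rfl⟩)), ?_⟩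
      · unfold scTerms; simp only [mem_union]
        exact Or.inl (Or.inl (Or.inl (Or.inl (Or.inr (mem_diffs.mpr ⟨q, hq, p, hp, rfl⟩)))))
      · intro p' hp' q' hq' h
        apply hX2W p' hp' _ hdW
        apply Subset.antisymm (union_subset (hU p' (hPF hp')) sdiff_subset)
        intro i hi
        by_cases hip : i ∈ p'
        · exact mem_union_left _ hip
        · refine mem_union_right _ (mem_sdiff.mpr ⟨hi, fun h' => hip ?_⟩)
          rw [h] at h'; exact (mem_inter.mp h').1
  -- the hybrid family
  set cQ : Finset (Finset α) := Q.image fun q => U \ q with hcQ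
  have hcardcQ : #cQ = #Q := by
    refine card_image_of_injOn ?_
    intro q hq q' hq' h
    have h1 := congrArg (fun t => U \ t) h
    simp only [hcc (hU q (hQF (mem_coe.mp hq))), hcc (hU q' (hQF (mem_coe.mp hq')))] at h1
    exact h1
  have hdisj : Disjoint P cQ := by
    rw [Finset.disjoint_left]
    intro p hp hpc
    obtain ⟨q, hq, hqp⟩ := mem_image.mp hpc
    obtain ⟨i, hi⟩ := hint p (hPF hp) q (hQF hq)
    rw [← hqp, mem_inter, mem_sdiff] at hi
    exact hi.1.2 hi.2
  set H := P ∪ cQ with hH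
  have hcardH : #H = #P + #Q := by rw [card_union_of_disjoint hdisj, hcardcQ]
  -- the term set: small terms
  set T : Finset (Finset α) := ((P \\ P) ∪ (Q \\ Q) ∪ (P ⊼ Q)) ∪ D with hT
  have hmeetT : ∀ p ∈ P, ∀ q ∈ Q, p ∩ q ∈ scTerms P Q W := by
    intro p hp q hq
    rcases hsat p hp q hq with h | h
    · have e : p ∩ q = p \ (p \ q) := by
        ext i; simp only [mem_inter, mem_sdiff]; tauto
      rw [e]; unfold scTerms; simp only [mem_union]
      exact Or.inl (Or.inl (Or.inl (Or.inr (mem_diffs.mpr ⟨p, hp, _, h, rfl⟩))))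
    · have e : p ∩ q = q ⊓ (p ∪ (U \ q)) := by
        ext i; simp only [inf_eq_inter, mem_inter, mem_union, mem_sdiff]
        constructor
        · rintro ⟨hip, hiq⟩; exact ⟨hiq, Or.inl hip⟩
        · rintro ⟨hiq, h | h⟩
          · exact ⟨h, hiq⟩
          · exact absurd hiq h.2
      rw [e]; unfold scTerms; simp only [mem_union]
      exact Or.inl (Or.inr (mem_infs.mpr ⟨q, hq, _, h, rfl⟩))
  have hTsmall : ∀ t ∈ T, t ∈ scTerms P Q W ∧ ∃ f ∈ F, t ⊆ f := by
    intro t ht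
    rcases mem_union.mp ht with ht | ht
    · rcases mem_union.mp ht with ht | ht
      · rcases mem_union.mp ht with ht | ht
        · obtain ⟨a, ha, b, hb, rfl⟩ := mem_diffs.mp ht
          refine ⟨?_, a, hPF ha, sdiff_subset⟩; unfold scTerms; simp only [mem_union]
          exact Or.inl (Or.inl (Or.inl (Or.inl (Or.inl (Or.inl (Or.inl (mem_diffs.mpr ⟨a, ha, b, hb, rfl⟩)))))))
        · obtain ⟨a, ha, b, hb, rfl⟩ := mem_diffs.mp ht
          refine ⟨?_, a, hQF ha, sdiff_subset⟩; unfold scTerms; simp only [mem_union]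
          exact Or.inl (Or.inl (Or.inl (Or.inl (Or.inl (Or.inl (Or.inr (mem_diffs.mpr ⟨a, ha, b, hb, rfl⟩)))))))
      · obtain ⟨p, hp, q, hq, rfl⟩ := mem_infs.mp ht
        exact ⟨hmeetT p hp q hq, p, hPF hp, inter_subset_left⟩
    · exact ⟨(hDsmall t ht).1, (hDsmall t ht).2.1⟩
  -- the rank argument on `H`
  set M : ℕ := #U with hM
  let r : Finset α → ℤ := fun s => (if s ∈ P then 0 else (M : ℤ) + 1) - (#s : ℤ)
  have h0T : (∅ : Finset α) ∈ T :=
    mem_union_left _ (mem_union_left _ (mem_union_left _ (mem_diffs.mpr ⟨p₀, hp₀, p₀, hp₀, (by simp : p₀ \ p₀ = ∅)⟩)))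
  have hDT : D ⊆ T := subset_union_right
  have h0D : (∅ : Finset α) ∉ D := by
    intro h
    exact (hDsmall ∅ h).2.2.1 (mem_union_left _ (mem_diffs.mpr ⟨p₀, hp₀, p₀, hp₀, (by simp : p₀ \ p₀ = ∅)⟩))
  have hres : #H + #D ≤ #T := by
    refine ReservedTerms.card_add_card_le_card_of_reserved H T D r h0T hDT h0D ?_
    intro f hf g hg hne hr
    rcases mem_union.mp hf with hfP | hfc <;> rcases mem_union.mp hg with hgP | hgc
    · -- `P`/`P`
      have hle : #g ≤ #f := by
        have : r f ≤ r g := hr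
        simp only [r, if_pos hfP, if_pos hgP] at this; omega
      refine ⟨mem_union_left _ (mem_union_left _ (mem_union_left _ (mem_diffs.mpr ⟨f, hfP, g, hgP, rfl⟩))), ?_, ?_⟩
      · intro h0; exact hne (eq_of_subset_of_card_le (sdiff_eq_empty_iff_subset.mp h0) hle)
      · intro hD; exact (hDsmall _ hD).2.2.1 (mem_union_left _ (mem_diffs.mpr ⟨f, hfP, g, hgP, rfl⟩))
    · -- `P` before `co Q`: the meet `f ∩ q`
      obtain ⟨q, hq, rfl⟩ := mem_image.mp hgc
      have hmeet : f \ (U \ q) = f ∩ q := by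
        ext i; simp only [mem_sdiff, mem_inter]
        constructor
        · rintro ⟨hif, h⟩
          refine ⟨hif, ?_⟩
          by_contra hiq; exact h ⟨hU f (hPF hfP) hif, hiq⟩
        · rintro ⟨hif, hiq⟩; exact ⟨hif, fun h => h.2 hiq⟩
      rw [hmeet]
      refine ⟨mem_union_left _ (mem_union_right _ (mem_infs.mpr ⟨f, hfP, q, hq, rfl⟩)),
        (hint f (hPF hfP) q (hQF hq)).ne_empty, fun hD => (hDsmall _ hD).2.2.2 f hfP q hq rfl⟩
    · -- `co Q` before `P`: impossible along `r`
      exfalso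
      have hfP' : f ∉ P := fun h => (Finset.disjoint_left.mp hdisj) h hfc
      have : r f ≤ r g := hr
      simp only [r, if_neg hfP', if_pos hgP] at this
      obtain ⟨q, hq, rfl⟩ := mem_image.mp hfc
      have : #(U \ q) ≤ M := card_le_card sdiff_subset
      omega
    · -- `co Q`/`co Q`
      obtain ⟨q, hq, rfl⟩ := mem_image.mp hfc
      obtain ⟨q', hq', rfl⟩ := mem_image.mp hgc
      have hfP' : U \ q ∉ P := fun h => (Finset.disjoint_left.mp hdisj) h hfc
      have hgP' : U \ q' ∉ P := fun h => (Finset.disjoint_left.mp hdisj) h hgc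
      have hle : #(U \ q') ≤ #(U \ q) := by
        have : r (U \ q) ≤ r (U \ q') := hr
        simp only [r, if_neg hfP', if_neg hgP'] at this; omega
      have hdiff : (U \ q) \ (U \ q') = q' \ q := by
        ext i; simp only [mem_sdiff]
        constructor
        · rintro ⟨⟨hiU, hiq⟩, h⟩
          exact ⟨by by_contra h'; exact h ⟨hiU, h'⟩, hiq⟩
        · rintro ⟨hiq', hiq⟩; exact ⟨⟨hU q' (hQF hq') hiq', hiq⟩, fun h => h.2 hiq'⟩
      rw [hdiff]
      refine ⟨mem_union_left _ (mem_union_left _ (mem_union_right _ (mem_diffs.mpr ⟨q', hq', q, hq, rfl⟩))), ?_, ?_⟩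
      · intro h0
        have hsub : q' ⊆ q := sdiff_eq_empty_iff_subset.mp h0
        have : U \ q ⊆ U \ q' := sdiff_subset_sdiff subset_rfl hsub
        exact hne (eq_of_subset_of_card_le this hle)
      · intro hD; exact (hDsmall _ hD).2.2.1 (mem_union_right _ (mem_diffs.mpr ⟨q', hq', q, hq, rfl⟩))
  -- `T` consists of small terms: `#clU U T = 2 #T` and `clU U T ⊆ clU U (scTerms P Q W)`
  have hTU : ∀ t ∈ T, t ⊆ U := by
    intro t ht
    obtain ⟨-, f, hf, htf⟩ := hTsmall t ht
    exact htf.trans (hU f hf)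
  have hclT : #(clU U T) = 2 * #T := by
    unfold clU
    have hinj : Set.InjOn (fun s : Finset α => U \ s) ↑T := by
      intro s hs t ht hst
      have h1 := congrArg (fun x => U \ x) hst
      simp only [hcc (hTU s (mem_coe.mp hs)), hcc (hTU t (mem_coe.mp ht))] at h1
      exact h1
    have hd : Disjoint T (T.image fun s => U \ s) := by
      rw [Finset.disjoint_left]
      intro t ht htc
      obtain ⟨s, hs, hst⟩ := mem_image.mp htc
      obtain ⟨-, f, hf, htf⟩ := hTsmall t ht
      obtain ⟨-, g, hg, hsg⟩ := hTsmall s hs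
      apply hcov f hf g hg
      apply Subset.antisymm (union_subset (hU f hf) (hU g hg))
      intro i hiU
      rw [mem_union]
      by_cases his : i ∈ s
      · exact Or.inr (hsg his)
      · have : i ∈ U \ s := mem_sdiff.mpr ⟨hiU, his⟩
        rw [hst] at this
        exact Or.inl (htf this)
    rw [card_union_of_disjoint hd, card_image_of_injOn hinj]; ring
  have hsTU : ∀ t ∈ scTerms P Q W, t ⊆ U := ExtReserved.scTerms_subset_ground hU hWU
  have hsub : clU U T ⊆ clU U (scTerms P Q W) := by
    intro s hs
    rcases mem_clU.mp hs with h | ⟨t, ht, rfl⟩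
    · exact mem_clU.mpr (Or.inl (hTsmall s h).1)
    · exact compl_mem_clU hsTU (hTU t ht) (mem_clU.mpr (Or.inl (hTsmall t ht).1))
  have := card_le_card hsub
  rw [hclT] at this
  omega

end Hybrid

end Summit.CriticalPhenomena.PercolationContinuityZ3.Theorems
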